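import Mathlib

/-!
# The discrete Riccati inequality with slack (planted pinning, deficit line)

Route `PlantedPinning` of `Ising3DConformalLimit`, crux item stmt-CriticalPhenomena-8451
(`PinningEfficiencyDeficit`), stub `stub_riccatiWithSlack` (S3) of the birth line.

Pure real arithmetic, no Ising objects.  Write `e_j = j v_j / ((n+1)(n−j+1))` for the planted
pinning efficiency.  The ceiling `0 ≤ e_j ≤ 1` (`1 ≤ j ≤ n`) and the one-pin Riccati step with
slack `v_{j+1} ≤ v_j − (1+s) v_j² / (n−j)²` on the density window `k ≤ 2j < 2k` integrate to
`e_k ≤ 1 / (1 + s/3)`: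

* `1/v_{j+1} ≥ 1/v_j + (1+s)/(n−j)²` on the window (if `v_k > 0`; otherwise the claim is trivial),
* telescoped from `m = ⌈k/2⌉` to `k` with `1/(n−j)² ≥ 1/(n−j) − 1/(n−j+1)`,
* the ceiling at `m` (`1/v_m ≥ m / ((n+1)(n−m+1))`), and `3(k−m) ≥ k`, `n+1 ≥ n−m+1`.

Compare `PlantedPinningCeiling.riccati_bound` (the case `s = 0` on the whole range `j < n`).
-/

namespace Summit.CriticalPhenomena.Ising3DConformalLimit.PlantedPinningDeficit

/-- **One reciprocal Riccati step with slack**: `0 < a`, `0 < b`, `0 ≤ c` and `b ≤ a − c a²`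
give `1/a + c ≤ 1/b` (since `b (1 + c a) ≤ (a − c a²)(1 + c a) = a − c² a³ ≤ a`). -/
theorem one_div_add_le_of_riccati_step {a b c : ℝ} (ha : 0 < a) (hb : 0 < b) (hc : 0 ≤ c)
    (h : b ≤ a - c * a ^ 2) : 1 / a + c ≤ 1 / b := by
  have h1 : b * (1 + c * a) ≤ a := by
    have h2 := mul_le_mul_of_nonneg_right h (by positivity : (0 : ℝ) ≤ 1 + c * a)
    have h3 : (a - c * a ^ 2) * (1 + c * a) = a - c ^ 2 * a ^ 3 := by ring
    have h4 : 0 ≤ c ^ 2 * a ^ 3 := by positivity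
    linarith
  rw [div_add' _ _ _ ha.ne', div_le_div_iff₀ ha hb]
  linarith

/-- **The telescoping comparison** `1/d − 1/(d+1) ≤ 1/d²` for `0 < d`. -/
theorem one_div_sub_one_div_succ_le {d : ℝ} (hd : 0 < d) : 1 / d - 1 / (d + 1) ≤ 1 / d ^ 2 := by
  rw [div_sub_div _ _ hd.ne' (by positivity), div_le_div_iff₀ (by positivity) (by positivity)]
  nlinarith

/-- **S3 — the discrete Riccati inequality with slack on a window.**
If `0 ≤ s`, `2 ≤ k ≤ n`, the efficiencies `e_j = j v_j/((n+1)(n−j+1))` lie in `[0,1]` for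
`1 ≤ j ≤ n`, and `v_{j+1} ≤ v_j − (1+s) v_j²/(n−j)²` whenever `k ≤ 2j`, `j < k`, then
`e_k ≤ 1/(1 + s/3)`. -/
theorem stub_riccatiWithSlack : ∀ (n k : ℕ) (s : ℝ) (v : ℕ → ℝ), 0 ≤ s → 2 ≤ k → k ≤ n → (∀ j : ℕ, 1 ≤ j → j ≤ n → 0 ≤ (j : ℝ) * v j / (((n : ℝ) + 1) * ((n : ℝ) - j + 1)) ∧ (j : ℝ) * v j / (((n : ℝ) + 1) * ((n : ℝ) - j + 1)) ≤ 1) → (∀ j : ℕ, k ≤ 2 * j → j < k → v (j + 1) ≤ v j - (1 + s) * v j ^ 2 / ((n : ℝ) - j) ^ 2) → (k : ℝ) * v k / (((n : ℝ) + 1) * ((n : ℝ) - k + 1)) ≤ 1 / (1 + s / 3) := by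
  intro n k s v hs hk2 hkn hceil hstep
  -- the midpoint `m = ⌈k/2⌉`: `k ≤ 2m`, `m < k`, `3m ≤ 2k`
  obtain ⟨m, hkm, hmk, h3m⟩ : ∃ m : ℕ, k ≤ 2 * m ∧ m < k ∧ 3 * m ≤ 2 * k :=
    ⟨(k + 1) / 2, by omega, by omega, by omega⟩
  have hm1 : 1 ≤ m := by omega
  have hmn : m ≤ n := by omega
  -- real casts of the index facts
  have hkR : (k : ℝ) ≤ n := by exact_mod_cast hkn
  have hmkR : (m : ℝ) + 1 ≤ k := by exact_mod_cast hmk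
  have h3mR : 3 * (m : ℝ) ≤ 2 * k := by exact_mod_cast h3m
  have hm0R : (0 : ℝ) ≤ m := Nat.cast_nonneg m
  have hk0R : (0 : ℝ) ≤ k := Nat.cast_nonneg k
  -- the three denominators are positive
  have hA : 0 < (n : ℝ) + 1 := by positivity
  have hB : 0 < (n : ℝ) - k + 1 := by linarith
  have hC : 0 < (n : ℝ) - m + 1 := by linarith
  have hAB : 0 < ((n : ℝ) + 1) * ((n : ℝ) - k + 1) := mul_pos hA hB
  have hAC : 0 < ((n : ℝ) + 1) * ((n : ℝ) - m + 1) := mul_pos hA hC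
  rcases le_or_gt (v k) 0 with hvk | hvk
  · -- `v k ≤ 0`: the efficiency is `≤ 0 ≤ 1/(1+s/3)`
    have h1 : (k : ℝ) * v k / (((n : ℝ) + 1) * ((n : ℝ) - k + 1)) ≤ 0 :=
      div_nonpos_of_nonpos_of_nonneg (mul_nonpos_of_nonneg_of_nonpos hk0R hvk) hAB.le
    have h2 : 0 < 1 / (1 + s / 3) := by positivity
    linarith
  · -- `0 < v k`: the reciprocal bound along the window, by induction upwards from `m`
    have claim : ∀ j : ℕ, m ≤ j → j ≤ k → 0 < v j →
        0 < v m ∧ 1 / v m + (1 + s) * (1 / ((n : ℝ) - j + 1) - 1 / ((n : ℝ) - m + 1)) ≤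
          1 / v j := by
      intro j hmj
      induction j, hmj using Nat.le_induction with
      | base =>
        intro _ hvm
        exact ⟨hvm, by simp⟩
      | succ j hmj ih =>
        intro hjk hvj1
        have hjk' : j < k := hjk
        have h2j : k ≤ 2 * j := by omega
        have hs1 := hstep j h2j hjk'
        obtain ⟨d, hd⟩ : ∃ d : ℝ, (n : ℝ) - j = d := ⟨_, rfl⟩
        have hd1 : 1 ≤ d := by
          have : (j : ℝ) + 1 ≤ n := by exact_mod_cast (lt_of_lt_of_le hjk' hkn)
          rw [← hd]; linarith
        have hd0 : 0 < d := by linarith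
        rw [hd] at hs1
        have hc : 0 ≤ (1 + s) / d ^ 2 := by positivity
        have hs2 : v (j + 1) ≤ v j - (1 + s) / d ^ 2 * v j ^ 2 := by
          have : (1 + s) * v j ^ 2 / d ^ 2 = (1 + s) / d ^ 2 * v j ^ 2 := by ring
          linarith
        have hle : v (j + 1) ≤ v j := by
          have : 0 ≤ (1 + s) / d ^ 2 * v j ^ 2 := by positivity
          linarith
        have hvj : 0 < v j := lt_of_lt_of_le hvj1 hle
        obtain ⟨hvm, ihb⟩ := ih hjk'.le hvj
        refine ⟨hvm, ?_⟩
        -- `1 / v j + (1+s)/d² ≤ 1 / v (j+1)`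
        have hkey : 1 / v j + (1 + s) / d ^ 2 ≤ 1 / v (j + 1) :=
          one_div_add_le_of_riccati_step hvj hvj1 hc hs2
        -- `(1+s) (1/d − 1/(d+1)) ≤ (1+s)/d²`
        have htel : (1 + s) * (1 / d - 1 / (d + 1)) ≤ (1 + s) / d ^ 2 := by
          have h' := mul_le_mul_of_nonneg_left (one_div_sub_one_div_succ_le hd0)
            (by linarith : (0 : ℝ) ≤ 1 + s)
          have h'' : (1 + s) * (1 / d ^ 2) = (1 + s) / d ^ 2 := by ring
          linarith
        rw [hd] at ihb
        push_cast
        have hden1 : (n : ℝ) - ((j : ℝ) + 1) + 1 = d := by rw [← hd]; ring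
        rw [hden1]
        have hsplit : (1 + s) * (1 / d - 1 / ((n : ℝ) - m + 1)) =
            (1 + s) * (1 / (d + 1) - 1 / ((n : ℝ) - m + 1)) + (1 + s) * (1 / d - 1 / (d + 1)) := by
          ring
        linarith [hkey, htel, ihb, hsplit]
    obtain ⟨hvm, hrec⟩ := claim k hmk.le le_rfl hvk
    -- the ceiling at `m`: `m v_m ≤ (n+1)(n−m+1)`, i.e. `m/((n+1)(n−m+1)) ≤ 1/v_m`
    have hcm : (m : ℝ) * v m ≤ ((n : ℝ) + 1) * ((n : ℝ) - m + 1) :=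
      (div_le_one hAC).1 (hceil m hm1 hmn).2
    have hinv : (m : ℝ) / (((n : ℝ) + 1) * ((n : ℝ) - m + 1)) ≤ 1 / v m := by
      rw [div_le_div_iff₀ hAC hvm]; linarith
    -- the rational inequality behind `e_k ≤ 1/(1+s/3)`
    have hpoly : (k : ℝ) * (1 + s / 3) / (((n : ℝ) + 1) * ((n : ℝ) - k + 1)) ≤
        (m : ℝ) / (((n : ℝ) + 1) * ((n : ℝ) - m + 1)) +
          (1 + s) * (1 / ((n : ℝ) - k + 1) - 1 / ((n : ℝ) - m + 1)) := by
      have hA0 : (n : ℝ) + 1 ≠ 0 := hA.ne'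
      have hB0 : (n : ℝ) - k + 1 ≠ 0 := hB.ne'
      have hC0 : (n : ℝ) - m + 1 ≠ 0 := hC.ne'
      have key : (m : ℝ) / (((n : ℝ) + 1) * ((n : ℝ) - m + 1)) +
          (1 + s) * (1 / ((n : ℝ) - k + 1) - 1 / ((n : ℝ) - m + 1)) -
            (k : ℝ) * (1 + s / 3) / (((n : ℝ) + 1) * ((n : ℝ) - k + 1)) =
          (((n : ℝ) - k + 1) * m + (1 + s) * ((n : ℝ) + 1) * ((k : ℝ) - m) -
              (k : ℝ) * (1 + s / 3) * ((n : ℝ) - m + 1)) /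
            (((n : ℝ) + 1) * ((n : ℝ) - k + 1) * ((n : ℝ) - m + 1)) := by
        field_simp
        ring
      have hnum : 0 ≤ ((n : ℝ) - k + 1) * m + (1 + s) * ((n : ℝ) + 1) * ((k : ℝ) - m) -
          (k : ℝ) * (1 + s / 3) * ((n : ℝ) - m + 1) := by
        have p1 : 0 ≤ s * (((n : ℝ) + 1) * (2 * (k : ℝ) - 3 * m)) :=
          mul_nonneg hs (mul_nonneg hA.le (by linarith))
        have p2 : 0 ≤ s * ((k : ℝ) * m) := mul_nonneg hs (mul_nonneg hk0R hm0R)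
        nlinarith [p1, p2]
      have hdiff : 0 ≤ (m : ℝ) / (((n : ℝ) + 1) * ((n : ℝ) - m + 1)) +
          (1 + s) * (1 / ((n : ℝ) - k + 1) - 1 / ((n : ℝ) - m + 1)) -
            (k : ℝ) * (1 + s / 3) / (((n : ℝ) + 1) * ((n : ℝ) - k + 1)) := by
        rw [key]
        exact div_nonneg hnum (mul_pos hAB hC).le
      linarith
    -- assemble: `k (1+s/3) / ((n+1)(n−k+1)) ≤ 1 / v k`
    have hfin : (k : ℝ) * (1 + s / 3) / (((n : ℝ) + 1) * ((n : ℝ) - k + 1)) ≤ 1 / v k := by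
      linarith
    rw [div_le_div_iff₀ hAB hvk] at hfin
    rw [div_le_div_iff₀ hAB (by positivity)]
    linarith

end Summit.CriticalPhenomena.Ising3DConformalLimit.PlantedPinningDeficit
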